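import Summits.HubbardSuperconductivity.HubbardLadder.ClusterCutOct12It4Frame11Qa
import Summits.HubbardSuperconductivity.HubbardLadder.ClusterCutOct12It4Frame11Qb
import Summits.HubbardSuperconductivity.HubbardLadder.ClusterCutOct12It4Frame11L
import Summits.HubbardSuperconductivity.HubbardLadder.PsdCertFactor
import HarnessLib

/-!
# Kernel frame certificate, piece 11: the PSD kernel facts (supplied-factor shape + residual bands)

HONEST FRAMING: ladder R1–R4 with certified numbers; no claim on H/H₀.  Cell pub-hubbard, lane r2-eng-1 (g13).  Split off the certificate module
`ClusterCutOct12It4Frame11` (which imports this file and derives `Q ⪰ 0` inside `it4Frame11`) so that no module's kernel time approaches the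
gate's 600-s elaboration wall: here `it4Shape11` (`psdShape`) and the `ddBand` facts `it4DD11_k` on the literal block `it4Q11` (assembled here as `it4Q11a ++ it4Q11b`), all by `decide +kernel`.  All statements [folklore].
-/

namespace Summit.HubbardSuperconductivity.HubbardLadder.ClusterCut

open Summit.HubbardSuperconductivity.HubbardLadder.PsdCert

/-- The literal block `Q = 65536·(B + 744800·G)` of piece 11 (121 × 121), assembled from its two row blocks. -/
noncomputable def it4Q11 : List (List ℤ) := it4Q11a ++ it4Q11b

set_option maxRecDepth 16384 in
set_option maxHeartbeats 4000000 in
/-- Kernel: shape facts of the supplied-factor certificate. -/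
theorem it4Shape11 : psdShape 121 1099511627776 it4D11 it4L11 it4Q11 = true := by
  decide +kernel

set_option maxRecDepth 16384 in
set_option maxHeartbeats 4000000 in
/-- Kernel residual band 0: rows [0, 71) of `s²Q − L̂D̂L̂ᵀ` are diagonally dominant. -/
theorem it4DD11_0 : ddBand 1099511627776 it4D11 it4L11 it4Q11 0 71 = true := by
  decide +kernel

set_option maxRecDepth 16384 in
set_option maxHeartbeats 4000000 in
/-- Kernel residual band 1: rows [71, 107) of `s²Q − L̂D̂L̂ᵀ` are diagonally dominant. -/
theorem it4DD11_1 : ddBand 1099511627776 it4D11 it4L11 it4Q11 71 36 = true := by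
  decide +kernel

set_option maxRecDepth 16384 in
set_option maxHeartbeats 4000000 in
/-- Kernel residual band 2: rows [107, 121) of `s²Q − L̂D̂L̂ᵀ` are diagonally dominant. -/
theorem it4DD11_2 : ddBand 1099511627776 it4D11 it4L11 it4Q11 107 14 = true := by
  decide +kernel

end Summit.HubbardSuperconductivity.HubbardLadder.ClusterCut
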